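import Literature.MathematicalPhysics.QuantumFieldTheory.Balaban1983to89.B9Eq347MiddleWordPiSupGradGlobal
import Literature.MathematicalPhysics.QuantumFieldTheory.Balaban1983to89.B11Eq117TransformationNormComp

/-!
# `Balaban1983to89.B11Eq117MiddleWordPiTransformationNorm` — T. Bałaban, *The variational problem and background fields in renormalization group method for
# lattice gauge theories*, Commun. Math. Phys. **102** (1985) 277–309 [Balaban1985Variational] (117) p. 295 *«By Theorem 3.13 of [5] the norm max{|·|_{(−1)},
# |∇·|_{(−2)}} of the transformation can be estimated by B₀|J|_{(−3)} + …»*, (110)–(111) p. 294 (*«𝔊 = G − GQ\*(QGQ\*)⁻¹QG − GDRD\*G»*), with [5] =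
# [Balaban1985BackgroundPropagators] Thm 3.13 p. 426, (3.147) p. 425, (3.153) p. 426: **THE (117) SOCKET FED ON THE MODEL FOR THE SECOND WORD `H̃_kQ_kG̃_k` OF `𝔊̃_k`
# — `‖toCLM115 ∇_U (H̃_kQ_kG̃_k)‖ ≤ max(w̄₀·B, w̄₁·B)·w̲⁻¹` with ONE height-free `B`** — the NE9 owner's socket `B11Eq117TransformationNormComp.norm_toCLM115_le_of_comp`
# (t4-ne9-p1 g96) applied to this lineage's (J-3) `B9Eq347MiddleWordPiSupGradGlobal.exists_global_supGrad_H1kPiQkG1kPi`: the value row gives `M_T`, the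
# COVARIANT-GRADIENT row gives `M_{∇T}`, both `= B`; the owner's (T4F) `B11Eq117GtildeTransformationNorm` (the FIRST word `G̃_k`) byte for byte but for the supplier

statement-level skeleton of published theorems with citation tags; proofs where landed; nothing here is a claim about the Yang–Mills mass gap

CITATION HEADER (lean-in-tree rule).  Audit cell `pub-balaban`, sub-cell `t4`, BINDER row NE9; NE9 crux-team LEAF PROVER 01 (`b2b-balaban-t4-ne9-formalise-leaf-01`, gen 91;
(J-4); bears_on: R4/N22).  The NE9 owner's RULING R-ne9p1-g97-4 (2)(d) «the socket» for the second word (memo `t4/b2b-balaban-t4-ne9-p1/g97/PLAN-V16-SEED.md` §6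
(V-117): «until [STOREY H] the socket can be fed for the FIRST WORD ONLY» — after (J-1)…(J-3) it is fed for the first TWO words; the third word's `hDT` is STOREY H).
Source locators as in (T4F) ([Balaban1985Variational] p. 294 (115), p. 295 (116)–(118), `paper:balaban1985-cmp102-variational-background`, journal page = PDF page + 276;
[Balaban1985BackgroundPropagators] p. 425 (3.147), p. 426 (3.153), Thm 3.13), read through the audited headers of (T4F) and (K82).  COMPOSED BY NAME: `norm_toCLM115_le_of_comp`
(owner) and `exists_global_supGrad_H1kPiQkG1kPi` (J-3); Mathlib's `pi_norm_le_iff_of_nonneg`, `norm_le_pi_norm`.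

WHAT IS PROVED (sorry-free; proof lane — 0 `def`; [folklore] bookkeeping).  **`exists_norm_toCLM115_H1kPiQkG1kPi_le`** — `∃ α₁ j₁ B, 0 < α₁ ∧ 0 < j₁ ∧ 0 ≤ B ∧ ∀ ⟨the
binder block of (J-3) VERBATIM through `hQ`⟩ (Lw ηw : ℝ) [Fact (0 < Lw)] [Fact (0 < ηw)] (lev₀ : bonds → ℕ) (lev₁ : bonds × Fin d → ℕ),
‖toCLM115 (L := Lw) (η := ηw) (lev₀ := lev₀) lev₁ (∇_U) (H̃_kQ_kG̃_k read on plain bond functions)‖ ≤ max(w̄₀·B, w̄₁·B)·w̲⁻¹` where `∇_U = B9Eq33CovDerivVector.covGrad η⁻¹ (Ad U)`,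
`H̃_kQ_kG̃_k = H1LatticeK hposπ hQ ∘ₗ QkW ∘ₗ G1LatticeK hposπ` read through `WL2.linearEquiv`, `w̄₀ = wSup (levWeight Lw ηw lev₀ 1)`, `w̄₁ = wSup (levWeight Lw ηw lev₁ 2)`,
`w̲⁻¹ = wInvSup (levWeight Lw ηw lev₀ 3)`.
HONEST SCOPE.  Norm bookkeeping BY NAME; `B` symbolic; the weights of (115) symbolic (print's multi-level `(L^jη)^{−α}` profile is NOT valued); `hposπ`, `hQ`, `hc₀`, `‖J‖ ≤ j₀`
and the MODEL letters stay DISPLAYED as in (J-3); NOT the (117) bound for `𝔊̃_k` (second word only; first word = (T4F); third word's gradient = STOREY H), NOT `B₀|J|_{(−3)}`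
with print's `B₀`; nothing of [B11] (117)∕Prop. 4 or [B9] Thm 3.13 is asserted, valued or discharged.  NOT NE9 (cell pub-balaban: NE9 NOT PRINTED ∕ NOT PROVED; «NE9 ⇐
the named binders»; row WALLED ON A MODEL (O-NE9-1; #5 UNRULED); spine PROVED 0∕9; rung (B)+1 on a finite T⁴ — NOT infinite volume, NOT mass gap, NOT BetaPertH, NOT Clay;
HONEST DEPENDENCY: continuum YM on T⁴ ⇐ BetaPertH ∧ nine spine estimates (0/9 proved); BetaPertH ⇐ (D1) ∧ (D4) ∧ CAP+tail; G-an2-4 gates asym, D1 and NE2/3/4).  NEW file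
importing (J-3) and `B11Eq117TransformationNormComp`; nothing modified.  Net new unproved facts: 0.
-/

noncomputable section

set_option autoImplicit false

open scoped InnerProductSpace ComplexConjugate BigOperators

namespace Literature.MathematicalPhysics.QuantumFieldTheory.Balaban1983to89.B11Eq117MiddleWordPiTransformationNorm

open B4Sect5Torus (TSite)
open B9SectCLatticeCarrier (Bond bpos btgt unshift)
open B9Eq311L2Pairing (WL2)
open B9Eq33CovDerivVector (covGrad)
open B7Prop1Explicit (U1 Wcx boxVec)
open B11Eq103H1Complex (SiteL2K BondL2K covDerivL2K covDivL2K G1LatticeK H1LatticeK)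
open B9Eq310DeltaPrime (plaqHolU)
open B9Eq310HessianOperator (adTransportW)
open B9Eq315QTorus (perCfg cornerSite)
open B9Eq315QTower (towerP UlevOf)
open B9Eq326OperatorTower (laplaceAk QkW)
open B9Eq324DeltaPrimeATower (laplacePrimeAk)
open B9Eq3119DeltaPiTower (laplaceAkPi)
open B11Eq115Space (NegSup levWeight)
open B11Eq111FrakG (toCLM115)
open B11Eq117TransformationNormComp (norm_toCLM115_le_of_comp)
open B9Eq347MiddleWordPiSupGradGlobal (exists_global_supGrad_H1kPiQkG1kPi)

variable {d : ℕ} (hd : 1 ≤ d) (L : ℕ) [NeZero L] (hL : 1 ≤ L) (hL3 : 3 ≤ L)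
  {𝔸 : Type*} [NormedRing 𝔸] [NormedAlgebra ℂ 𝔸] [CompleteSpace 𝔸] [NormOneClass 𝔸] [StarRing 𝔸] [NormedStarGroup 𝔸] [StarModule ℂ 𝔸]
  {W : Type*} [NormedAddCommGroup W] [InnerProductSpace ℂ W] [FiniteDimensional ℂ W] (φ : W ≃ₗ[ℂ] 𝔸)
  {Mφ Mφ' : ℝ} (hMφ : 0 ≤ Mφ) (hMφ' : 0 ≤ Mφ') (hφ : ∀ w, ‖φ w‖ ≤ Mφ * ‖w‖) (hφ' : ∀ X, ‖φ.symm X‖ ≤ Mφ' * ‖X‖) (hstar : ∀ X : 𝔸, ‖star X‖ ≤ ‖X‖)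
  {a : ℝ} (ha : 0 < a) {a' : ℝ} (ha' : 0 < a') {ϱ : ℝ} (hϱ0 : 0 ≤ ϱ) (hϱ1 : ϱ < 1)
  (τ : 𝔸 →ₗ[ℂ] ℂ) {Cτ : ℝ} (hτ : ∀ X, ‖τ X‖ ≤ Cτ * ‖X‖) (hCτ : 0 ≤ Cτ) {Mτ : ℝ} (hτm : ∀ X Y : 𝔸, ‖τ (X * Y)‖ ≤ Mτ * ‖X‖ * ‖Y‖) (hMτ : 0 ≤ Mτ)
  {ρw : ℝ} (hρw : 0 ≤ ρw)
  (hτ₁ : ∀ X : 𝔸, τ (star X) = conj (τ X)) (hτ₂ : ∀ X Y : 𝔸, τ (X * Y) = τ (Y * X)) (hφτ : ∀ X Y : 𝔸, ⟪φ.symm X, φ.symm Y⟫_ℂ = τ (star X * Y))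
  (AQ : ℝ)

set_option maxHeartbeats 400000 in -- as the owner's (T4F): the ≈ 50-binder supplier + the (115) socket; the defeq assembly exceeds the default budget
include hd hL hL3 hMφ hMφ' hφ hφ' hstar ha ha' hϱ0 hϱ1 hτ hCτ hτm hMτ hρw hτ₁ hτ₂ hφτ in
/-- **THE (117) SOCKET FED FOR THE SECOND WORD `H̃_kQ_kG̃_k` OF `𝔊̃_k` — `‖toCLM115 ∇_U (H̃_kQ_kG̃_k)‖ ≤ max(w̄₀·B, w̄₁·B)·w̲⁻¹`, ONE height-free `B`**, for every
height, spacing on the diagonal, period, background of the MODEL letters in the window `α ≤ α₁`, `‖J‖ ≤ j₀ ≤ j₁`, the positivity witnesses, the right-inverse witness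
`hQ`, print's weight, and ANY level functions ∕ weight parameters of (115); the owner's (T4F) `exists_norm_toCLM115_G1kPi_le` BYTE FOR BYTE with (J-3)
`exists_global_supGrad_H1kPiQkG1kPi` (conjuncts 1 and 3) in place of (T4C). [cite: Balaban1985Variational, (117) p.295, (115) p.294, (110)–(111) p.294;
Balaban1985BackgroundPropagators, Thm 3.13 p.426, (3.147) p.425, (3.153) p.426] -/
theorem exists_norm_toCLM115_H1kPiQkG1kPi_le :
    ∃ α₁ j₁ B : ℝ, 0 < α₁ ∧ 0 < j₁ ∧ 0 ≤ B ∧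
      ∀ (n : ℕ) (η : ℝ) (_hηL : η * (L : ℝ) ^ (n + 1) = 1) (c₀ c₁ : ℝ) [Fact (0 < c₀)] [Fact (0 < c₁)]
        (_hw : c₀ * ((L : ℝ) ^ (n + 1)) ^ d = c₁) (_hρ : |η| ^ d / c₀ ≤ ρw) (m : Fin d → ℕ) [∀ i, NeZero (m i)] (_hm : ∀ i, 1 ≤ m i)
        (U : Bond d (towerP L m (n + 1)) → 𝔸ˣ) (αU : ℕ → ℝ) (_hα0 : ∀ j, 0 ≤ αU j) (hα1 : ∀ j, αU j ≤ 1 / 64)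
        (hαL : ∀ j, 50 * (d + 1) * αU j * (L : ℝ) ^ d ≤ 1 / 2)
        (hU1 : ∀ (j : ℕ) (x : B7Prop1Explicit.Site d) (k : Fin d), perCfg (towerP L m (j + 1)) (UlevOf L m (n + 1) U j) x k ∈ U1 𝔸)
        (hreg : ∀ (j : ℕ) (y : TSite d (towerP L m j)) (k : Fin d) (ρ' : Fin d → Fin L),
          ‖((Wcx L (perCfg (towerP L m (j + 1)) (UlevOf L m (n + 1) U j)) (cornerSite L y) k (boxVec L ρ') : 𝔸ˣ) : 𝔸) - 1‖ ≤ αU j)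
        (εU : ℕ → ℝ) (_hεU : ∀ j, 0 ≤ εU j) (_hUε : ∀ (j : ℕ) (b : Bond d (towerP L m (j + 1))), ‖(UlevOf L m (n + 1) U j b : 𝔸) - 1‖ ≤ εU j)
        (_hLb : ∀ (j : ℕ) (b : Bond d (towerP L m (j + 1))), UlevOf L m (n + 1) U j b ∈ U1 𝔸)
        (α : ℝ) (_hα : 0 ≤ α) (_hαle : α ≤ α₁)
        (hUst : ∀ b, star (U b : 𝔸) = (((U b)⁻¹ : 𝔸ˣ) : 𝔸)) (_hUb : ∀ b, U b ∈ U1 𝔸) (_hUη : ∀ b, ‖(U b : 𝔸) - 1‖ ≤ α * η)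
        (_hpl : ∀ p : B9SectCLatticeCarrier.Plaq d (towerP L m (n + 1)), ‖(plaqHolU U p : 𝔸) - 1‖ ≤ α * η ^ 2)
        (_hUgrad : ∀ (x : TSite d (towerP L m (n + 1))) (μ : Fin d), ‖(U (x, μ) : 𝔸) - U (unshift μ x, μ)‖ ≤ α * η ^ 2)
        (_hRlev : ∀ (j : ℕ) (b : Bond d (towerP L m (j + 1))) (w : W), ‖adTransportW φ (UlevOf L m (n + 1) U j) b w‖ ≤ ‖w‖)
        (_hεg : ∀ j < n + 1, εU j ≤ α * ϱ ^ j) (_hAQ : ∑ j ∈ Finset.range (n + 1), αU j ≤ AQ)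
        (hpos' : ∀ x : SiteL2K ℂ d (towerP L m (n + 1)) c₀ W, x ≠ 0 → 0 < RCLike.re ⟪x, laplacePrimeAk L m n φ η U a' (c₁ := c₁) x⟫_ℂ)
        (hpos : ∀ x : BondL2K ℂ d (towerP L m (n + 1)) c₀ W, x ≠ 0 →
          0 < RCLike.re ⟪x, laplaceAk L m n φ η U hL αU hα1 hU1 hreg τ (c₀ := c₀) (c₁ := c₁) a x⟫_ℂ)
        (_hc₀η : c₀ = η ^ d) (j₀ : ℝ) (_hJ : ∀ μ y, ‖B9Eq39Adjoint.J (fun μ => B9Eq33CovDerivVector.shiftEquiv μ) (fun μ y => U (y, μ)) η μ y‖ ≤ j₀) (_hj : j₀ ≤ j₁)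
        (hposπ : ∀ x : BondL2K ℂ d (towerP L m (n + 1)) c₀ W, x ≠ 0 →
          0 < RCLike.re ⟪x, laplaceAkPi L m n φ τ η U a' hpos' hL αU hα1 hU1 hreg (c₁ := c₁) a x⟫_ℂ)
        (hQ : Function.Surjective (QkW L m n φ U hL αU hα1 hU1 hreg (c₀ := c₀) (c₁ := c₁)))
        (Lw ηw : ℝ) [Fact (0 < Lw)] [Fact (0 < ηw)] (lev₀ : Bond d (towerP L m (n + 1)) → ℕ) (lev₁ : Bond d (towerP L m (n + 1)) × Fin d → ℕ),
        ‖toCLM115 (L := Lw) (η := ηw) (lev₀ := lev₀) lev₁ (covGrad ((η : ℂ))⁻¹ (adTransportW φ U))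
            ((WL2.linearEquiv ℂ ℂ (fun _ : Bond d (towerP L m (n + 1)) => c₀)).toLinearMap ∘ₗ ((H1LatticeK hposπ hQ : _ →ₗ[ℂ] _) ∘ₗ (QkW L m n φ U hL αU hα1 hU1 hreg (c₀ := c₀) (c₁ := c₁)) ∘ₗ (G1LatticeK hposπ : _ →ₗ[ℂ] _)) ∘ₗ
              ((WL2.linearEquiv ℂ ℂ (fun _ : Bond d (towerP L m (n + 1)) => c₀)).symm.toLinearMap :
                (Bond d (towerP L m (n + 1)) → W) →ₗ[ℂ] BondL2K ℂ d (towerP L m (n + 1)) c₀ W))‖ ≤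
          max ((NegSup.wSup (levWeight Lw ηw lev₀ 1) : ℝ) * B) (NegSup.wSup (levWeight Lw ηw lev₁ 2) * B) *
            NegSup.wInvSup (levWeight Lw ηw lev₀ 3) := by
  classical
  obtain ⟨α₁, j₁, B, hα₁, hj₁, hB, HG⟩ := exists_global_supGrad_H1kPiQkG1kPi hd L hL hL3 φ hMφ hMφ' hφ hφ' hstar ha ha' hϱ0 hϱ1 τ hτ hCτ hτm hMτ hρw hτ₁ hτ₂ hφτ AQ
  refine ⟨α₁, j₁, B, hα₁, hj₁, hB, ?_⟩
  intro n η hηL c₀ c₁ _ _ hw hρ m _ hm U αU hα0 hα1 hαL hU1 hreg εU hεU hUε hLb α hα hαle hUst hUb hUη hpl hUgrad hRlev hεg hAQ hpos' hpos hc₀η j₀ hJ hj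
    hposπ hQ Lw ηw _ _ lev₀ lev₁
  have Hk := HG n η hηL c₀ c₁ hw hρ m hm U αU hα0 hα1 hαL hU1 hreg εU hεU hUε hLb α hα hαle hUst hUb hUη hpl hUgrad hRlev hεg hAQ hpos' hpos hc₀η j₀ hJ hj
    hposπ hQ
  -- the transformation read on plain bond functions
  have hT : ∀ (g : Bond d (towerP L m (n + 1)) → W) (x : Bond d (towerP L m (n + 1))),
      ((WL2.linearEquiv ℂ ℂ (fun _ : Bond d (towerP L m (n + 1)) => c₀)).toLinearMap ∘ₗ ((H1LatticeK hposπ hQ : _ →ₗ[ℂ] _) ∘ₗ (QkW L m n φ U hL αU hα1 hU1 hreg (c₀ := c₀) (c₁ := c₁)) ∘ₗ (G1LatticeK hposπ : _ →ₗ[ℂ] _)) ∘ₗ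
        ((WL2.linearEquiv ℂ ℂ (fun _ : Bond d (towerP L m (n + 1)) => c₀)).symm.toLinearMap :
          (Bond d (towerP L m (n + 1)) → W) →ₗ[ℂ] BondL2K ℂ d (towerP L m (n + 1)) c₀ W)) g x =
        WL2.equiv ℂ (fun _ : Bond d (towerP L m (n + 1)) => c₀) W
          (H1LatticeK hposπ hQ (QkW L m n φ U hL αU hα1 hU1 hreg (c₀ := c₀) (c₁ := c₁) (G1LatticeK hposπ ((WL2.equiv ℂ (fun _ : Bond d (towerP L m (n + 1)) => c₀) W).symm g)))) x := fun _ _ => rfl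
  have hgM : ∀ (g : Bond d (towerP L m (n + 1)) → W) (b : Bond d (towerP L m (n + 1))),
      ‖WL2.equiv ℂ (fun _ : Bond d (towerP L m (n + 1)) => c₀) W
        ((WL2.equiv ℂ (fun _ : Bond d (towerP L m (n + 1)) => c₀) W).symm g) b‖ ≤ ‖g‖ := fun g b => by
    rw [Equiv.apply_symm_apply]; exact norm_le_pi_norm g b
  refine norm_toCLM115_le_of_comp lev₁ _ _ hB hB (fun g => ?_) (fun g => ?_)
  · refine (pi_norm_le_iff_of_nonneg (mul_nonneg hB (norm_nonneg g))).2 fun x => ?_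
    rw [hT]
    exact (Hk ((WL2.equiv ℂ (fun _ : Bond d (towerP L m (n + 1)) => c₀) W).symm g) ‖g‖ (norm_nonneg g) (hgM g) ⟨0, hd⟩ x).1
  · refine (pi_norm_le_iff_of_nonneg (mul_nonneg hB (norm_nonneg g))).2 fun bμ => ?_
    obtain ⟨b, μ⟩ := bμ
    have e : (((WL2.linearEquiv ℂ ℂ (fun _ : Bond d (towerP L m (n + 1)) => c₀)).toLinearMap ∘ₗ ((H1LatticeK hposπ hQ : _ →ₗ[ℂ] _) ∘ₗ (QkW L m n φ U hL αU hα1 hU1 hreg (c₀ := c₀) (c₁ := c₁)) ∘ₗ (G1LatticeK hposπ : _ →ₗ[ℂ] _)) ∘ₗ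
        ((WL2.linearEquiv ℂ ℂ (fun _ : Bond d (towerP L m (n + 1)) => c₀)).symm.toLinearMap :
          (Bond d (towerP L m (n + 1)) → W) →ₗ[ℂ] BondL2K ℂ d (towerP L m (n + 1)) c₀ W)) g : Bond d (towerP L m (n + 1)) → W) =
        WL2.equiv ℂ (fun _ : Bond d (towerP L m (n + 1)) => c₀) W
          (H1LatticeK hposπ hQ (QkW L m n φ U hL αU hα1 hU1 hreg (c₀ := c₀) (c₁ := c₁) (G1LatticeK hposπ ((WL2.equiv ℂ (fun _ : Bond d (towerP L m (n + 1)) => c₀) W).symm g)))) := funext (hT g)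
    rw [e]
    exact (Hk ((WL2.equiv ℂ (fun _ : Bond d (towerP L m (n + 1)) => c₀) W).symm g) ‖g‖ (norm_nonneg g) (hgM g) μ b).2.2

end Literature.MathematicalPhysics.QuantumFieldTheory.Balaban1983to89.B11Eq117MiddleWordPiTransformationNorm

end
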